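import Mathlib
import HarnessLib
import Summits.HubbardSuperconductivity.HubbardSuperconductivity.Theorems.KLProgrammeC4aTubeTadpole

/-!
# Route `KLProgramme` — crux C4a: the `L¹(dϑ)` CO-MOVING JET INVARIANT `CoMovingJetsL1` (the typed target of sub-lemma (L3)) and the
# tube tadpole-jet theorem in its headline form «jet constants × slice mass»

Cell `gate-hubbard-kl`, lane hubbard-kl-c4a-1 (g2); helper for the engine-flow child `KLRegimeEngineV17F2` (stmt-HubbardSuperconductivity-20437),
stub (C) `stub_twoLeg_curvature` (memo HOME/hubbard-kl-c4a-1/C4A-PLAN.md §2c «L¹(dϑ) because the Cooper log is integrable», §6 (L2)/(L3), (J_n)).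

WHY AN `L¹` FORM.  `CoMovingJets A r μ K V` (…C4aInvariantDefs §3) asks for SUP bounds of the co-moving jets.  The scale-restricted
particle–particle bubble summed over the scales above `n` — the second-order fat vertex — has, at the Cooper configuration `q ≈ −k`
(`|k + q| ≍ Λ_n`), value AND co-moving jets of size `≍ Σ_{m<n} min(1, Λ_m/|k+q|) ≍ n`: a sup bound carries BGM's `|h|`.  Integrated over
the relative loop angle the same quantity is `Σ_m Λ_m log(1/Λ_m) = O(1)`: the dominators `a_i(ρ, ϑ_rel)` are integrable on the chart box with
`n`-FREE integrals.  This file names that property and reads the (L2) capstone through it: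

* §1 `CoMovingJetsL1 N a r μ K V` — `C^N` co-moving readings whose `i`-th jets (`i ≤ N`) at base angles `(θ, ϑ + θ)` are dominated by
  `a_i(ρ, ϑ)` uniformly in `θ`, each `a_i` integrable on `(−r,r) ×ˢ (0,2π]`; accessors; `CoMovingJets.toL1` (sup ⇒ L¹ with constant
  dominators); `.mono`; `.add` (the fat vertex is a sum of channel pieces); `.const_smul` (running-coupling prefactors);
* §2 `setIntegral_box_norm_mul_le_of_unif`: if `∫_{(0,2π]} a_i(ρ, ϑ) dϑ ≤ M_i` uniformly in the level then
  `∫_{box} ‖f(ρ)‖·a_i(ρ,ϑ) ≤ M_i · ∫_{(−r,r)} ‖f‖` (Fubini);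
* §3 `norm_iteratedDeriv_tubeTadpole_le_of_L1` (the capstone keyed by the predicate) and the HEADLINE
  `norm_iteratedDeriv_tubeTadpole_le_of_L1_unif`: `‖∂_θʲ ∫_{tube} f(e_K q)·V(Φ(0,θ), q) dq‖ ≤ (Σ_{i≤j} C(j,i)·G_i·M_{j−i}) · ∫_{(−r,r)} ‖f‖`
  — Jacobian jets × uniform `L¹(dϑ)` co-moving jet norms × slice MASS; with `n`-free `M` (the (L3) deliverable) a tangential derivative of
  any order costs NOTHING against the scale away from the umklapp corners.

Definitions + theorems; nothing is asserted about the Hubbard model.  References: FST II CPAM 51 (1998) 1133 §3 (Thm 3.5, the change of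
variables; the Cooper logarithm is integrable in the angle); BGM 2006 §2.4, (2.36) [cite: BenfattoGiulianiMastropietro2006].
-/

noncomputable section

namespace Summit.HubbardSuperconductivity.HubbardSuperconductivity.Theorems.C4a

set_option linter.dupNamespace false -- summit = problem name (single-conjunct summit), D-0017

open Real Set MeasureTheory Filter
open scoped ContDiff Topology
open Literature.MathematicalPhysics.QuantumLattice Literature.MathematicalPhysics.QuantumLattice.BandSectorCounting
open Summit.HubbardSuperconductivity.HubbardSuperconductivity.Theorems.DispersionFlow
open Summit.HubbardSuperconductivity.HubbardSuperconductivity.Theorems.KLRegimeSplit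
open Summit.HubbardSuperconductivity.HubbardSuperconductivity.Theorems.PerturbedFermiCurve

/-! ## §1 The `L¹(dϑ)` co-moving jet invariant -/

/-- **(J-L¹) `CoMovingJetsL1 N a r μ K V`** — INTEGRATED CO-MOVING JETS: for all base angles `θ`, levels `|ρ| < r` and relative loop angles
`ϑ`, the co-moving reading `coMoving μ K V θ ρ (ϑ + θ)` is `C^N` and its `i`-th jet at time `0` (`i ≤ N`) is dominated by `a_i(ρ, ϑ)`,
UNIFORMLY in `θ`, each dominator being integrable on the chart box `(−r, r) ×ˢ (0, 2π]`.  The (L3) deliverable for the fat vertices, with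
`n`-free `L¹` norms of the `a_i` (the sup form `CoMovingJets` would carry `|h|` at the Cooper configuration). -/
def CoMovingJetsL1 (N : ℕ) (a : ℕ → ℝ × ℝ → ℝ) (r μ : ℝ) (K : TrigPolyC4v) (V : Momentum → Momentum → ℂ) : Prop :=
  (∀ i ≤ N, IntegrableOn (a i) (Ioo (-r) r ×ˢ Ioc 0 (2 * π))) ∧
    ∀ θ ρ ϑ : ℝ, |ρ| < r →
      ContDiff ℝ N (coMoving μ K V θ ρ (ϑ + θ)) ∧ ∀ i ≤ N, ‖iteratedDeriv i (coMoving μ K V θ ρ (ϑ + θ)) 0‖ ≤ a i (ρ, ϑ)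

namespace CoMovingJetsL1

variable {N : ℕ} {a a' : ℕ → ℝ × ℝ → ℝ} {r μ : ℝ} {K : TrigPolyC4v} {V V₁ V₂ : Momentum → Momentum → ℂ}

/-- Accessor: the dominators are integrable on the chart box. -/
theorem integrableOn (h : CoMovingJetsL1 N a r μ K V) {i : ℕ} (hi : i ≤ N) :
    IntegrableOn (a i) (Ioo (-r) r ×ˢ Ioc 0 (2 * π)) := h.1 i hi

/-- Accessor: smoothness of the co-moving reading. -/
theorem contDiff (h : CoMovingJetsL1 N a r μ K V) (θ : ℝ) {ρ : ℝ} (hρ : |ρ| < r) (ϑ : ℝ) :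
    ContDiff ℝ N (coMoving μ K V θ ρ (ϑ + θ)) := (h.2 θ ρ ϑ hρ).1

/-- Accessor: the pointwise domination of the `i`-th co-moving jet (base angles `(θ, ϑ + θ)`, time `0`). -/
theorem le (h : CoMovingJetsL1 N a r μ K V) (θ : ℝ) {ρ : ℝ} (hρ : |ρ| < r) (ϑ : ℝ) {i : ℕ} (hi : i ≤ N) :
    ‖iteratedDeriv i (coMoving μ K V θ ρ (ϑ + θ)) 0‖ ≤ a i (ρ, ϑ) := (h.2 θ ρ ϑ hρ).2 i hi

/-- **Monotonicity**: larger integrable dominators. -/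
theorem mono (h : CoMovingJetsL1 N a r μ K V) (haa' : ∀ i ≤ N, ∀ p, a i p ≤ a' i p)
    (ha' : ∀ i ≤ N, IntegrableOn (a' i) (Ioo (-r) r ×ˢ Ioc 0 (2 * π))) : CoMovingJetsL1 N a' r μ K V :=
  ⟨ha', fun θ _ ϑ hρ => ⟨h.contDiff θ hρ ϑ, fun i hi => (h.le θ hρ ϑ hi).trans (haa' i hi _)⟩⟩

/-- **Additivity** (the fat vertex is a sum of channel pieces): dominators add. -/
theorem add (h₁ : CoMovingJetsL1 N a r μ K V₁) (h₂ : CoMovingJetsL1 N a' r μ K V₂) :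
    CoMovingJetsL1 N (fun i p => a i p + a' i p) r μ K (fun k q => V₁ k q + V₂ k q) := by
  refine ⟨fun i hi => (h₁.integrableOn hi).add (h₂.integrableOn hi), fun θ ρ ϑ hρ => ?_⟩
  have hsum : coMoving μ K (fun k q => V₁ k q + V₂ k q) θ ρ (ϑ + θ) =
      coMoving μ K V₁ θ ρ (ϑ + θ) + coMoving μ K V₂ θ ρ (ϑ + θ) := by
    funext t; simp [coMoving]
  refine ⟨by rw [hsum]; exact (h₁.contDiff θ hρ ϑ).add (h₂.contDiff θ hρ ϑ), fun i hi => ?_⟩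
  rw [hsum, iteratedDeriv_add ((h₁.contDiff θ hρ ϑ).contDiffAt.of_le (by exact_mod_cast hi))
    ((h₂.contDiff θ hρ ϑ).contDiffAt.of_le (by exact_mod_cast hi))]
  exact (norm_add_le _ _).trans (add_le_add (h₁.le θ hρ ϑ hi) (h₂.le θ hρ ϑ hi))

/-- **Scalar prefactors** (running couplings): `c • V` has dominators `‖c‖·a_i`. -/
theorem const_smul (h : CoMovingJetsL1 N a r μ K V) (c : ℂ) :
    CoMovingJetsL1 N (fun i p => ‖c‖ * a i p) r μ K (fun k q => c * V k q) := by
  refine ⟨fun i hi => (h.integrableOn hi).const_mul _, fun θ ρ ϑ hρ => ?_⟩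
  have hsm : coMoving μ K (fun k q => c * V k q) θ ρ (ϑ + θ) = fun t => c * coMoving μ K V θ ρ (ϑ + θ) t := by
    funext t; simp [coMoving]
  refine ⟨by rw [hsm]; exact contDiff_const.mul (h.contDiff θ hρ ϑ), fun i hi => ?_⟩
  rw [hsm, iteratedDeriv_const_mul c (((h.contDiff θ hρ ϑ).contDiffAt).of_le (by exact_mod_cast hi)), norm_mul]
  exact mul_le_mul_of_nonneg_left (h.le θ hρ ϑ hi) (norm_nonneg _)

end CoMovingJetsL1

/-- **Sup ⇒ L¹**: bounded co-moving jets give integrated ones with CONSTANT dominators (on a bounded box constants are integrable). -/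
theorem CoMovingJets.toL1 {A : ℕ → ℝ} {r μ : ℝ} {K : TrigPolyC4v} {V : Momentum → Momentum → ℂ} (h : CoMovingJets A r μ K V) :
    CoMovingJetsL1 4 (fun i _ => A i) r μ K V := by
  have hfin : volume (Ioo (-r) r ×ˢ Ioc 0 (2 * π)) ≠ ⊤ :=
    ((Metric.isBounded_Ioo (-r) r).prod (Metric.isBounded_Ioc 0 (2 * π))).measure_lt_top.ne
  refine ⟨fun i _ => integrableOn_const hfin, fun θ ρ ϑ hρ => ?_⟩
  have h' := h θ ρ (ϑ + θ) hρ.le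
  exact ⟨by exact_mod_cast h'.1, fun i hi => h'.2 i hi⟩

/-! ## §2 Uniform `L¹(dϑ)` norms against the slice mass -/

/-- **Fubini against a uniform angular `L¹` bound**: if `a` is integrable on the box, `f` is continuous, and `∫_{(0,2π]} a(ρ, ϑ) dϑ ≤ M` for
every level `ρ ∈ (−r, r)`, then `∫_{(−r,r)×(0,2π]} ‖f(ρ)‖·a(ρ,ϑ) ≤ M · ∫_{(−r,r)} ‖f‖`. -/
theorem setIntegral_box_norm_mul_le_of_unif {f : ℝ → ℂ} (hf : Continuous f) {a : ℝ × ℝ → ℝ} {r M : ℝ}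
    (ha : IntegrableOn a (Ioo (-r) r ×ˢ Ioc 0 (2 * π))) (hM : ∀ ρ ∈ Ioo (-r) r, ∫ ϑ in Ioc 0 (2 * π), a (ρ, ϑ) ≤ M) :
    ∫ p in Ioo (-r) r ×ˢ Ioc 0 (2 * π), ‖f p.1‖ * a p ≤ M * ∫ ρ in Ioo (-r) r, ‖f ρ‖ := by
  -- ‖f‖ is bounded on the closed level range
  obtain ⟨C, hC⟩ : ∃ C, ∀ ρ ∈ Icc (-r) r, ‖f ρ‖ ≤ C := by
    obtain ⟨C, hC⟩ := isCompact_Icc.exists_bound_of_continuousOn (hf.continuousOn (s := Icc (-r) r))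
    exact ⟨C, hC⟩
  have hfmeas : AEStronglyMeasurable (fun p : ℝ × ℝ => ‖f p.1‖) (volume.restrict (Ioo (-r) r ×ˢ Ioc 0 (2 * π))) :=
    (continuous_norm.comp (hf.comp continuous_fst)).aestronglyMeasurable
  have hfbd : ∀ᵐ p ∂(volume.restrict (Ioo (-r) r ×ˢ Ioc 0 (2 * π))), ‖(fun p : ℝ × ℝ => ‖f p.1‖) p‖ ≤ C := by
    filter_upwards [ae_restrict_mem (measurableSet_Ioo.prod measurableSet_Ioc)] with p hp
    rw [norm_norm]
    exact hC p.1 (Ioo_subset_Icc_self (mem_prod.1 hp).1)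
  have hprod : IntegrableOn (fun p : ℝ × ℝ => ‖f p.1‖ * a p) (Ioo (-r) r ×ˢ Ioc 0 (2 * π)) := ha.bdd_mul hfmeas hfbd
  rw [Measure.volume_eq_prod] at hprod ⊢
  rw [setIntegral_prod _ hprod, ← integral_const_mul]
  -- compare the inner integrals level by level
  have hfI : IntegrableOn (fun ρ : ℝ => ‖f ρ‖) (Ioo (-r) r) :=
    ((continuous_norm.comp hf).continuousOn.integrableOn_compact isCompact_Icc).mono_set Ioo_subset_Icc_self
  refine setIntegral_mono_on ?_ (hfI.const_mul M) measurableSet_Ioo fun ρ hρ => ?_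
  · have h2 : Integrable (fun p : ℝ × ℝ => ‖f p.1‖ * a p)
        (((volume : Measure ℝ).restrict (Ioo (-r) r)).prod ((volume : Measure ℝ).restrict (Ioc 0 (2 * π)))) := by
      rw [Measure.prod_restrict]; exact hprod
    exact h2.integral_prod_left
  · simp only
    rw [integral_const_mul]
    rw [mul_comm M]
    exact mul_le_mul_of_nonneg_left (hM ρ hρ) (norm_nonneg _)

/-! ## §3 The tube tadpole-jet theorem keyed by `CoMovingJetsL1` -/

section Tube

variable {a b : ℝ} (B : BandBounds a b) {K : TrigPolyC4v} {A : ℝ}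
  (hA : ∀ p : Momentum, ∀ j ≤ 2, ‖iteratedFDeriv ℝ j (frameShift K) p‖ ≤ A) (hADt : 2 * A < B.Dtmin)
  {μ r : ℝ} (hr : 0 < r) (hlo : a < μ - r - A) (hhi : μ + r + A < b)
include B hA hADt hr hlo hhi

/-- **The tube tadpole-jet theorem, (J-L¹) form.** -/
theorem norm_iteratedDeriv_tubeTadpole_le_of_L1 {f : ℝ → ℂ} (hf : ContDiff ℝ ∞ f) (hfsupp : tsupport f ⊆ Ioo (-r) r)
    {N : ℕ} {G : ℕ → ℝ} (hJjet : ∀ ρ, |ρ| < r → ∀ i ≤ N, ∀ s, ‖iteratedDeriv i (fun s => levelChartJac μ K (ρ, s)) s‖ ≤ G i)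
    {V : Momentum → Momentum → ℂ} (hV : ContDiff ℝ ∞ fun x : Momentum × Momentum => V x.1 x.2)
    {aV : ℕ → ℝ × ℝ → ℝ} (hVJ : CoMovingJetsL1 N aV r μ K V) {j : ℕ} (hj : j ≤ N) (θ : ℝ) :
    ‖iteratedDeriv j (fun θ : ℝ =>
        ∫ q in {q : ℝ × ℝ | |q.1| < π ∧ |q.2| < π ∧ |frameLevel μ K (WithLp.toLp 2 ![q.1, q.2])| < r},
          f (frameLevel μ K (WithLp.toLp 2 ![q.1, q.2])) * V (levelPoint μ K 0 θ) (WithLp.toLp 2 ![q.1, q.2])) θ‖ ≤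
      ∑ i ∈ Finset.range (j + 1), (j.choose i : ℝ) * G i *
        ∫ p in Ioo (-r) r ×ˢ Ioc 0 (2 * π), ‖f p.1‖ * aV (j - i) p :=
  norm_iteratedDeriv_tubeTadpole_le B hA hADt hr hlo hhi hf hfsupp hJjet hV (fun _ hi => hVJ.integrableOn hi)
    (fun θ _ ϑ hρ _ hi => hVJ.le θ hρ ϑ hi) hj θ

/-- **HEADLINE FORM: jet constants × uniform `L¹(dϑ)` co-moving norms × slice mass.**  If moreover `∫_{(0,2π]} a_i(ρ,ϑ) dϑ ≤ M_i` uniformly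
in the level `ρ ∈ (−r, r)` (`i ≤ N`), then for `j ≤ N` and every `θ`:
`‖∂_θʲ ∫_{tube} f(e_K q)·V(Φ(0,θ), q) dq‖ ≤ (Σ_{i≤j} C(j,i)·G_i·M_{j−i}) · ∫_{(−r,r)} ‖f‖`. -/
theorem norm_iteratedDeriv_tubeTadpole_le_of_L1_unif {f : ℝ → ℂ} (hf : ContDiff ℝ ∞ f) (hfsupp : tsupport f ⊆ Ioo (-r) r)
    {N : ℕ} {G : ℕ → ℝ} (hJjet : ∀ ρ, |ρ| < r → ∀ i ≤ N, ∀ s, ‖iteratedDeriv i (fun s => levelChartJac μ K (ρ, s)) s‖ ≤ G i)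
    {V : Momentum → Momentum → ℂ} (hV : ContDiff ℝ ∞ fun x : Momentum × Momentum => V x.1 x.2)
    {aV : ℕ → ℝ × ℝ → ℝ} (hVJ : CoMovingJetsL1 N aV r μ K V)
    {M : ℕ → ℝ} (hM : ∀ i ≤ N, ∀ ρ ∈ Ioo (-r) r, ∫ ϑ in Ioc 0 (2 * π), aV i (ρ, ϑ) ≤ M i) {j : ℕ} (hj : j ≤ N) (θ : ℝ) :
    ‖iteratedDeriv j (fun θ : ℝ =>
        ∫ q in {q : ℝ × ℝ | |q.1| < π ∧ |q.2| < π ∧ |frameLevel μ K (WithLp.toLp 2 ![q.1, q.2])| < r},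
          f (frameLevel μ K (WithLp.toLp 2 ![q.1, q.2])) * V (levelPoint μ K 0 θ) (WithLp.toLp 2 ![q.1, q.2])) θ‖ ≤
      (∑ i ∈ Finset.range (j + 1), (j.choose i : ℝ) * G i * M (j - i)) * ∫ ρ in Ioo (-r) r, ‖f ρ‖ := by
  refine (norm_iteratedDeriv_tubeTadpole_le_of_L1 B hA hADt hr hlo hhi hf hfsupp hJjet hV hVJ hj θ).trans ?_
  rw [Finset.sum_mul]
  refine Finset.sum_le_sum fun i hi => ?_
  have hij : j - i ≤ N := (Nat.sub_le j i).trans hj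
  have hI := setIntegral_box_norm_mul_le_of_unif hf.continuous (hVJ.integrableOn hij) (hM (j - i) hij)
  have hG : 0 ≤ G i := by
    have h0 := hJjet 0 (by simpa using hr) i (Nat.lt_succ_iff.mp (Finset.mem_range.mp hi) |>.trans hj) 0
    exact (norm_nonneg _).trans h0
  have hC : (0 : ℝ) ≤ (j.choose i : ℝ) * G i := mul_nonneg (Nat.cast_nonneg _) hG
  calc (j.choose i : ℝ) * G i * ∫ p in Ioo (-r) r ×ˢ Ioc 0 (2 * π), ‖f p.1‖ * aV (j - i) p
      ≤ (j.choose i : ℝ) * G i * (M (j - i) * ∫ ρ in Ioo (-r) r, ‖f ρ‖) := mul_le_mul_of_nonneg_left hI hC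
    _ = (j.choose i : ℝ) * G i * M (j - i) * ∫ ρ in Ioo (-r) r, ‖f ρ‖ := by ring

end Tube

end Summit.HubbardSuperconductivity.HubbardSuperconductivity.Theorems.C4a
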